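import Literature.Probability.RandomPlanarGeometry.SLEBubblesThm65Kappa
import Literature.Probability.RandomPlanarGeometry.RestrictionSemigroup
import Literature.Probability.RandomPlanarGeometry.RestrictionHullsProofs
import Literature.Probability.RandomPlanarGeometry.LoewnerTraceFunctional
import Literature.Probability.RandomPlanarGeometry.SLESixHullLocalityEvents
import Literature.Probability.RandomPlanarGeometry.ConformalRestrictionProofs
import HarnessLib

/-!
# The tilted [LSW] Theorem 6.5 (line `boundary-area-law`, RS5b): the density of the tilt and the un-tilting step

Line `boundary-area-law` of the crux `SubseqIdentification` (stmt-CriticalPhenomena-0783, route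
`SAWRenewalTightness`), restriction reshape (lead c4, r-c4-3), stub RS5b `stub_thm65Tilted`: for
`0 < κ ≤ 8/3`, `A, B ∈ 𝒬*`, the restriction map `Φ = Φ_A` with `d = Φ_A′(0)`,
`E[1{γ ∩ A = ∅, Φ_A(γ(0,∞)) ∩ B = ∅} · X_A] = Φ_A′(0)^α · P[γ ∩ B = ∅]`,
`X_A = exp(−λ ∫₀^∞ m(A_t − W_t) dt)`, `α = (6 − κ)/(2κ)`, `λ = (8 − 3κ)(6 − κ)/(2κ)` — the Girsanov
reading of G. F. Lawler, O. Schramm, W. Werner, *Conformal restriction: the chordal case*, J. Amer.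
Math. Soc. 16 (2003), Prop. 5.3 with §5 (5.1)–(5.3): under the TILTED probability
`Q_A = (Y_∞ / Y_0) · P`, `Y` the bounded martingale `h_t′(W_t)^α e^{−λ ∫₀ᵗ m}` of Prop. 5.3, the
curve `Φ_A(γ)` is an SLE_κ.

This file proves the two measure-theoretic ends of that argument (milestones (T1) and (T7) of the
plan `RS5b-PLAN.md`), for EVERY compensated restriction martingale `Y` of the specification
`IsRestrictionMartingaleK κ α λ A (LpK κ A) Y` (which exists, `exists_isRestrictionMartingaleK`):

* **`ofReal_Yinf_ae_eq_thm65Fun`**, **`thm65_terminal_density`** — THE DENSITY OF THE TILT: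
  `Y_∞ = 1_{γ ∩ A = ∅} · X_A` almost surely, for every `A ∈ 𝒬*` (two-sided hulls included): the
  tree's Thm. 6.5 (`lintegral_thm65Fun_LpK_eq`) says the two sides have the same finite integral
  `Φ_A′(0)^α`, and `1_{T = ∞} e^{−λL_∞} ≤ Y_∞` a.s. by Lemma 6.2 (`thm65Fun_ae_le_ofReal_Yinf`);
* `ae_eq_setOf_disjoint_hullProduct` — the event bookkeeping
  `{γ ∩ A = ∅ ∧ Φ_A(γ(0,∞)) ∩ B = ∅} = {γ ∩ (B·A) = ∅}` a.s. for `0 < κ ≤ 4` (the trace is a simple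
  curve in `ℍ ∪ {0}`, Rohde–Schramm), and `nullMeasurableSet_setOf_disjoint` — avoidance events of
  closed sets are null-measurable;
* **`thm65Tilted_of_tilted`** — THE UN-TILTING: the registered identity for `(κ, A, B, Φ, d)` follows
  from `Q_A {γ ∩ (B·A) = ∅} = Φ_A′(0)^α · P {γ ∩ B = ∅}` for the tilted measure
  `Q_A = Y_∞ · P` (`Measure.withDensity`), i.e. from "under `Q_A`, `Φ_A(γ)` avoids `B` with the
  SLE_κ probability" — the output of the Girsanov/Lévy/Loewner block (T2)–(T6) of the plan;
* **`stub_thm65Tilted_empty`** — the registered statement for `A = ∅` (then `Φ = id` on `ℍ`,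
  `X_∅ = 1`, `d = 1`), unconditionally.

References: [LSW] Prop. 5.3, Thm. 6.5 and its proof (§6); Rohde–Schramm (2005) Thm. 6.1.
No named fact is used.
-/

noncomputable section

open MeasureTheory Filter Topology Set Metric
open scoped NNReal ENNReal
open Literature.Probability.RandomPlanarGeometry
open Literature.Probability.Process (preWienerMeasure)
open UpperHalfPlane (upperHalfPlaneSet)

namespace Summit.CriticalPhenomena.SAWScalingLimit.Theorems.SubseqIdentification.BoundaryAreaLaw

open Loewner

/-! ### The terminal value of the compensated restriction martingale -/

section Terminal

variable {κ : ℝ≥0} {α lam : ℝ} {A : Set ℂ} {L : ℝ≥0 → (ℝ≥0 → ℝ) → ℝ≥0∞} {Y : ℝ≥0 → (ℝ≥0 → ℝ) → ℝ}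

/-- `κ ≤ 8/3` implies `κ ≤ 4`. [folklore] -/
theorem le_four_of_le_eightThirds (hκ : κ ≤ 8 / 3) : κ ≤ 4 :=
  hκ.trans (by rw [div_le_iff₀ (by norm_num : (0 : ℝ≥0) < 3)]; norm_num)

/-- **`Y_∞ = 1_{T = ∞} e^{−λ L_∞}` almost surely, for EVERY `A ∈ 𝒬*`** (`0 < κ ≤ 8/3`,
`α = (6−κ)/(2κ)`, `λ = (8−3κ)(6−κ)/(2κ)`, compensator `LpK κ A`): both sides have integral `Φ_A′(0)^α`
([LSW] Thm. 6.5 in the tree, `lintegral_thm65Fun_LpK_eq`, and `E[Y_∞] = Φ_A′(0)^α` by dominated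
convergence), and `1_{T = ∞} e^{−λ L_∞} ≤ Y_∞` a.s. (Lemma 6.2 along SLE_κ).
[cite: LawlerSchrammWerner2003Restriction, Thm. 6.5 and its proof (§6)] -/
theorem ofReal_Yinf_ae_eq_thm65Fun (hκ0 : 0 < κ) (hκ : κ ≤ 8 / 3) (hαdef : α = (6 - κ) / (2 * κ))
    (hlamdef : lam = (8 - 3 * κ) * (6 - κ) / (2 * κ)) (hA : IsStarHull A)
    {Φ : ConformalEquiv (upperHalfPlaneSet \ A) upperHalfPlaneSet} (hΦ : IsRestrictionMap A Φ) {d : ℝ}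
    (hd : HasRestrictionDeriv A Φ d) (hY : IsRestrictionMartingaleK κ α lam A (LpK κ A) Y) :
    (fun ω ↦ ENNReal.ofReal (Yinf Y ω)) =ᵐ[preWienerMeasure] thm65Fun κ lam A (LpK κ A) := by
  obtain ⟨hαpos, -⟩ := exponents_pos hκ hαdef hlamdef hκ0
  have hκ4 := le_four_of_le_eightThirds hκ
  have huniq : IsStarHull.existsUnique_isRestrictionMap := IsStarHull.existsUnique_isRestrictionMap_holds
  have h62 := sle_restrictionDeriv_frequently_gtK_of_isStarHull hκ0 hκ4 hA
  have hle := hY.thm65Fun_ae_le_ofReal_Yinf hαpos hA h62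
  have heq : ∫⁻ ω, thm65Fun κ lam A (LpK κ A) ω ∂preWienerMeasure = ENNReal.ofReal (d ^ α) :=
    lintegral_thm65Fun_LpK_eq hκ0 hκ hαdef hlamdef hA hΦ hd
  have hg : AEMeasurable (fun ω ↦ ENNReal.ofReal (Yinf Y ω)) preWienerMeasure :=
    hY.measurable_Yinf.ennreal_ofReal.aemeasurable
  have hgf : ∫⁻ ω, ENNReal.ofReal (Yinf Y ω) ∂preWienerMeasure ≤ ∫⁻ ω, thm65Fun κ lam A (LpK κ A) ω ∂preWienerMeasure := by
    rw [heq, hY.lintegral_ofReal_Yinf_eq hαpos huniq hA hΦ hd h62]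
  exact (ae_eq_of_ae_le_of_lintegral_le hle (by rw [heq]; exact ENNReal.ofReal_ne_top) hg hgf).symm

/-- **THE DENSITY OF THE TILT — `Y_∞ = 1_{γ ∩ A = ∅} · X_A` a.s.**, in the vocabulary of the
registered statement (`X_A = 𝒫(λ_κ ∫₀^∞ m(A_t − W_t) dt)`, `𝒫(x) = e^{−x}`, `m = starBubbleMass`), for
`0 < κ ≤ 8/3`, a nonempty `A ∈ 𝒬*` and every compensated restriction martingale `Y` with
compensator `LpK κ A`. [cite: LawlerSchrammWerner2003Restriction, Thm. 6.5 and its proof (§6), with §7.2 (7.2)] -/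
theorem thm65_terminal_density (hκ0 : 0 < κ) (hκ : κ ≤ 8 / 3) (hA : IsStarHull A) (hne : A.Nonempty)
    {Φ : ConformalEquiv (upperHalfPlaneSet \ A) upperHalfPlaneSet} (hΦ : IsRestrictionMap A Φ) {d : ℝ}
    (hd : HasRestrictionDeriv A Φ d)
    (hY : IsRestrictionMartingaleK κ (sleBubbleExponent κ) (sleBubbleIntensityReal κ) A (LpK κ A) Y) :
    (fun ω ↦ ENNReal.ofReal (Yinf Y ω)) =ᵐ[preWienerMeasure] fun ω ↦
      {ω | Disjoint (range (sleTrace κ ω)) A}.indicator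
        (fun ω ↦ poissonAvoidance (sleBubbleIntensity κ *
          ∫⁻ t, ENNReal.ofReal (starBubbleMass (slidHull (sleDriving κ ω) A t)) ∂timeMeasure)) ω := by
  have hκ4 := le_four_of_le_eightThirds hκ
  exact (ofReal_Yinf_ae_eq_thm65Fun hκ0 hκ rfl rfl hA hΦ hd hY).trans
    (indicator_poissonAvoidance_ae_eq_thm65Fun hκ0 hκ4 hA hne (sleBubbleIntensityReal κ)).symm

end Terminal

/-! ### Event bookkeeping: avoidance of the product hull, null-measurability -/

section Events

variable {κ : ℝ≥0} {A B : Set ℂ} {Φ : ConformalEquiv (upperHalfPlaneSet \ A) upperHalfPlaneSet}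

/-- **`{γ ∩ A = ∅ ∧ Φ_A(γ(0,∞)) ∩ B = ∅} = {γ ∩ (B·A) = ∅}` almost surely** (`0 < κ ≤ 4`; `B·A` the
product hull `hullProduct B A Φ`, `ℍ ∖ (B·A) = Φ_A⁻¹(ℍ ∖ B)`): the SLE_κ trace is a simple curve in
`ℍ ∪ {0}` (Rohde–Schramm Thm. 6.1), so `disjoint_range_hullProduct_iff` applies pathwise.
[cite: LawlerSchrammWerner2003Restriction, §2 p. 8 (Semigroups) with Prop. 3.3 (1)] -/
theorem ae_eq_setOf_disjoint_hullProduct (hκ0 : 0 < κ) (hκ4 : κ ≤ 4) (hA : IsStarHull A) (hB : IsStarHull B)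
    (hΦ : IsRestrictionMap A Φ) :
    ({ω | Disjoint (range (sleTrace κ ω)) A ∧ ∀ t, 0 < t → Φ (sleTrace κ ω t) ∉ B} : Set (ℝ≥0 → ℝ)) =ᵐ[preWienerMeasure]
      ({ω | Disjoint (range (sleTrace κ ω)) (hullProduct B A Φ)} : Set (ℝ≥0 → ℝ)) := by
  obtain ⟨-, hsimple, -⟩ := sle_trace_facts_of_le_four hκ0 hκ4
  have hAc : IsClosed A := hA.isBoundedHull.isClosed
  have hBc : IsClosed B := hB.isBoundedHull.isClosed
  have hP : IsStarHull (hullProduct B A Φ) := hB.hullProduct hA hΦ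
  filter_upwards [hsimple] with ω hω
  exact propext (disjoint_range_hullProduct_iff hBc hAc hA.zero_notMem hP.zero_notMem (sleTrace_zero κ ω) hω.2).symm

/-- A `*`-hull is contained in each of its products `B·A` (`A = cl(A ∩ ℍ)` and `A ∩ ℍ ⊆ B·A`). [folklore] -/
theorem subset_hullProduct (hA : IsStarHull A) (B : Set ℂ) : A ⊆ hullProduct B A Φ := by
  intro z hz
  have hcl : z ∈ closure (A ∩ upperHalfPlaneSet) := by
    rw [hA.isBoundedHull.2.1]; exact hz
  exact closure_mono (fun w hw ↦ Or.inl hw) hcl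

/-- Avoiding `B·A` implies avoiding `A`. [folklore] -/
theorem setOf_disjoint_hullProduct_subset (hA : IsStarHull A) (B : Set ℂ) :
    ({ω | Disjoint (range (sleTrace κ ω)) (hullProduct B A Φ)} : Set (ℝ≥0 → ℝ)) ⊆
      {ω | Disjoint (range (sleTrace κ ω)) A} :=
  fun _ hω ↦ hω.mono_right (subset_hullProduct hA B)

/-- **Avoidance events of closed sets are null-measurable** (`0 < κ ≠ 8`): a.s. the trace is the
measurable trace functional `traceOf` of the driving path, for which `{firstHit = ⊤}` is Borel. [folklore] -/
theorem nullMeasurableSet_setOf_disjoint (hκ8 : κ ≠ 8) {C : Set ℂ} (hC : IsClosed C) :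
    NullMeasurableSet ({ω | Disjoint (range (sleTrace κ ω)) C} : Set (ℝ≥0 → ℝ)) preWienerMeasure := by
  have hgen : ∀ᵐ ω ∂preWienerMeasure, ∃ γ, IsGeneratedByCurve (sleDriving κ ω) γ := hasSLETrace_of_ne_eight_holds hκ8
  have hmeas : MeasurableSet ({ω | firstHit (traceOf (drivingPath κ ω)) C = ⊤} : Set (ℝ≥0 → ℝ)) :=
    (measurableSet_setOf_firstHit_eq_top hC).preimage (measurable_traceOf.comp (measurable_drivingPath κ))
  refine hmeas.nullMeasurableSet.congr ?_
  filter_upwards [hgen] with ω hω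
  have htr : ⇑(traceOf (drivingPath κ ω)) = sleTrace κ ω := coe_traceOf_drivingPath hω
  show (firstHit (traceOf (drivingPath κ ω)) C = ⊤) = Disjoint (range (sleTrace κ ω)) C
  rw [htr, firstHit_eq_top_iff_disjoint]

end Events

/-! ### Un-tilting: the registered identity from the tilted avoidance law -/

section Untilt

/-- `κ ≤ 8/3` implies `κ ≠ 8`. [folklore] -/
theorem ne_eight_of_le_eightThirds {κ : ℝ≥0} (hκ : κ ≤ 8 / 3) : κ ≠ 8 := by
  intro h
  have h' : ((κ : ℝ≥0) : ℝ) ≤ 8 / 3 := by exact_mod_cast hκ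
  rw [h] at h'; norm_num at h'

/-- **UN-TILTING (milestone (T7)).** Let `0 < κ ≤ 8/3`, `A ∈ 𝒬*` nonempty with restriction data
`(Φ, d)`, `B ∈ 𝒬*`, and let `Y` be a compensated restriction martingale of [LSW] Prop. 5.3 for `A`
(`IsRestrictionMartingaleK κ α_κ λ_κ A (LpK κ A) Y`; it exists, `exists_isRestrictionMartingaleK`), with
terminal value `Y_∞ = Yinf Y` and TILTED MEASURE `Q_A = Y_∞ · P`. If under `Q_A` the curve avoids the
product hull `B·A` — i.e. `Φ_A(γ)` avoids `B` — with mass `Φ_A′(0)^α · P[γ ∩ B = ∅]`, then the registered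
identity `E[1{γ ∩ A = ∅, Φ_A(γ(0,∞)) ∩ B = ∅} X_A] = Φ_A′(0)^α P[γ ∩ B = ∅]` holds: `Y_∞ = 1_{γ ∩ A = ∅} X_A`
(`thm65_terminal_density`) and `{γ ∩ A = ∅, Φ_A(γ) ∩ B = ∅} = {γ ∩ (B·A) = ∅} ⊆ {γ ∩ A = ∅}` a.s.
[cite: LawlerSchrammWerner2003Restriction, Prop. 5.3 with §5 (5.1)–(5.3) and Thm. 6.5] -/
theorem thm65Tilted_of_tilted :
    ∀ (κ : ℝ≥0), 0 < κ → κ ≤ 8 / 3 → ∀ (A B : Set ℂ), IsStarHull A → A.Nonempty → IsStarHull B →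
      ∀ (Φ : ConformalEquiv (upperHalfPlaneSet \ A) upperHalfPlaneSet), IsRestrictionMap A Φ →
        ∀ (d : ℝ), HasRestrictionDeriv A Φ d → ∀ (Y : ℝ≥0 → (ℝ≥0 → ℝ) → ℝ),
          IsRestrictionMartingaleK κ (sleBubbleExponent κ) (sleBubbleIntensityReal κ) A (LpK κ A) Y →
          (preWienerMeasure.withDensity fun ω => ENNReal.ofReal (Yinf Y ω))
              {ω | Disjoint (range (sleTrace κ ω)) (hullProduct B A Φ)} =
            ENNReal.ofReal (d ^ sleBubbleExponent κ) * preWienerMeasure {ω | Disjoint (range (sleTrace κ ω)) B} →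
          ∫⁻ ω, {ω | Disjoint (range (sleTrace κ ω)) A ∧ ∀ t, 0 < t → Φ (sleTrace κ ω t) ∉ B}.indicator
              (fun ω => poissonAvoidance (sleBubbleIntensity κ *
                ∫⁻ t, ENNReal.ofReal (starBubbleMass (Loewner.slidHull (sleDriving κ ω) A t)) ∂timeMeasure)) ω
            ∂preWienerMeasure =
          ENNReal.ofReal (d ^ sleBubbleExponent κ) * preWienerMeasure {ω | Disjoint (range (sleTrace κ ω)) B} := by
  intro κ hκ0 hκ A B hA hne hB Φ hΦ d hd Y hY htilt
  have hκ4 := le_four_of_le_eightThirds hκ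
  have hκ8 := ne_eight_of_le_eightThirds hκ
  set X : (ℝ≥0 → ℝ) → ℝ≥0∞ := fun ω ↦ poissonAvoidance (sleBubbleIntensity κ *
    ∫⁻ t, ENNReal.ofReal (starBubbleMass (slidHull (sleDriving κ ω) A t)) ∂timeMeasure) with hX
  set EA : Set (ℝ≥0 → ℝ) := {ω | Disjoint (range (sleTrace κ ω)) A} with hEA
  set EP : Set (ℝ≥0 → ℝ) := {ω | Disjoint (range (sleTrace κ ω)) (hullProduct B A Φ)} with hEP
  have hsub : EP ⊆ EA := setOf_disjoint_hullProduct_subset hA B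
  -- the integrand is `1_{E_{B·A}} · ρ`, `ρ = 1_{E_A} X_A = Y_∞`
  have h1 : (fun ω ↦ {ω | Disjoint (range (sleTrace κ ω)) A ∧ ∀ t, 0 < t → Φ (sleTrace κ ω t) ∉ B}.indicator X ω)
      =ᵐ[preWienerMeasure] fun ω ↦ EP.indicator X ω :=
    indicator_ae_eq_of_ae_eq_set (ae_eq_setOf_disjoint_hullProduct hκ0 hκ4 hA hB hΦ)
  have h2 : (fun ω ↦ EP.indicator X ω) = fun ω ↦ EP.indicator (fun ω ↦ EA.indicator X ω) ω := by
    funext ω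
    by_cases hω : ω ∈ EP
    · rw [indicator_of_mem hω, indicator_of_mem hω, indicator_of_mem (hsub hω)]
    · rw [indicator_of_notMem hω, indicator_of_notMem hω]
  have h3 : (fun ω ↦ EP.indicator (fun ω ↦ EA.indicator X ω) ω) =ᵐ[preWienerMeasure]
      fun ω ↦ EP.indicator (fun ω ↦ ENNReal.ofReal (Yinf Y ω)) ω := by
    filter_upwards [thm65_terminal_density hκ0 hκ hA hne hΦ hd hY] with ω hω
    by_cases hω' : ω ∈ EP
    · rw [indicator_of_mem hω', indicator_of_mem hω']; exact hω.symm
    · rw [indicator_of_notMem hω', indicator_of_notMem hω']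
  have hnull : NullMeasurableSet EP preWienerMeasure :=
    nullMeasurableSet_setOf_disjoint hκ8 (hB.hullProduct hA hΦ).isBoundedHull.isClosed
  rw [lintegral_congr_ae h1, h2, lintegral_congr_ae h3, lintegral_indicator₀ hnull, ← withDensity_apply' _ EP]
  exact htilt

end Untilt

/-! ### The empty hull -/

/-- **RS5b for the empty hull `A = ∅`, unconditionally** (the registered statement of
`stub_thm65Tilted` specialised to `A = ∅`): then `Φ = id` on `ℍ` (uniqueness of restriction maps),
`X_∅ = 1`, `d = 1`, and a.s. `γ(t) ∈ ℍ` for `t > 0` (simple trace), so both sides are `P[γ ∩ B = ∅]`.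
[cite: LawlerSchrammWerner2003Restriction, Thm. 6.5 (trivial case A = ∅)] -/
theorem stub_thm65Tilted_empty :
    ∀ (κ : ℝ≥0), 0 < κ → κ ≤ 8 / 3 → ∀ (B : Set ℂ), IsStarHull B →
      ∀ (Φ : ConformalEquiv (upperHalfPlaneSet \ (∅ : Set ℂ)) upperHalfPlaneSet), IsRestrictionMap ∅ Φ →
        ∀ (d : ℝ), HasRestrictionDeriv ∅ Φ d →
          ∫⁻ ω, {ω | Disjoint (range (sleTrace κ ω)) (∅ : Set ℂ) ∧ ∀ t, 0 < t → Φ (sleTrace κ ω t) ∉ B}.indicator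
              (fun ω => poissonAvoidance (sleBubbleIntensity κ *
                ∫⁻ t, ENNReal.ofReal (starBubbleMass (Loewner.slidHull (sleDriving κ ω) ∅ t)) ∂timeMeasure)) ω
            ∂preWienerMeasure =
          ENNReal.ofReal (d ^ sleBubbleExponent κ) * preWienerMeasure {ω | Disjoint (range (sleTrace κ ω)) B} := by
  intro κ hκ0 hκ B hB Φ hΦ d hd
  have hκ4 := le_four_of_le_eightThirds hκ
  have hκ8 := ne_eight_of_le_eightThirds hκ
  -- `d = 1`
  have hd1 : d = 1 := HasRestrictionDeriv.eq_of_isRestrictionMap IsStarHull.existsUnique_isRestrictionMap_holds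
    isStarHull_empty isRestrictionMap_empty hΦ hasRestrictionDeriv_empty hd
  -- `Φ = id` on `ℍ`
  have hid : ∀ z ∈ upperHalfPlaneSet, Φ z = z := by
    obtain ⟨Φ₀, -, hU⟩ := IsStarHull.existsUnique_isRestrictionMap_holds isStarHull_empty
    intro z hz
    have hz' : z ∈ upperHalfPlaneSet \ (∅ : Set ℂ) := ⟨hz, notMem_empty _⟩
    rw [hU Φ hΦ hz', ← hU restrictionMapEmpty isRestrictionMap_empty hz', restrictionMapEmpty_apply]
  -- the integrand is the indicator of `{∀ t > 0, Φ(γ t) ∉ B}`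
  set S : Set (ℝ≥0 → ℝ) := {ω | Disjoint (range (sleTrace κ ω)) (∅ : Set ℂ) ∧ ∀ t, 0 < t → Φ (sleTrace κ ω t) ∉ B} with hS
  have h1 : ∀ ω : ℝ≥0 → ℝ, S.indicator (fun ω ↦ poissonAvoidance (sleBubbleIntensity κ *
      ∫⁻ t, ENNReal.ofReal (starBubbleMass (slidHull (sleDriving κ ω) ∅ t)) ∂timeMeasure)) ω =
      S.indicator 1 ω := fun ω ↦ by
    by_cases hω : ω ∈ S
    · rw [indicator_of_mem hω, indicator_of_mem hω]
      simp [Loewner.slidHull_empty, starBubbleMass_empty]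
    · rw [indicator_of_notMem hω, indicator_of_notMem hω]
  -- a.s. `S = {γ ∩ B = ∅}`
  obtain ⟨-, hsimple, -⟩ := sle_trace_facts_of_le_four hκ0 hκ4
  have hBc : IsClosed B := hB.isBoundedHull.isClosed
  have hae : S =ᵐ[preWienerMeasure] ({ω | Disjoint (range (sleTrace κ ω)) B} : Set (ℝ≥0 → ℝ)) := by
    filter_upwards [hsimple] with ω hω
    have him : ∀ t, 0 < t → sleTrace κ ω t ∈ upperHalfPlaneSet := fun t ht ↦ hω.2 t ht
    have key : ω ∈ S ↔ Disjoint (range (sleTrace κ ω)) B := by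
      refine ⟨fun h ↦ ?_, fun h ↦ ⟨disjoint_empty _, fun t ht hmem ↦ ?_⟩⟩
      · rw [Set.disjoint_left]
        rintro _ ⟨t, rfl⟩ hmem
        rcases eq_or_ne t 0 with rfl | ht
        · exact hB.zero_notMem (by rwa [sleTrace_zero] at hmem)
        · have ht' : 0 < t := pos_iff_ne_zero.2 ht
          exact h.2 t ht' (by rw [hid _ (him t ht')]; exact hmem)
      · rw [hid _ (him t ht)] at hmem
        exact Set.disjoint_left.1 h (mem_range_self t) hmem
    exact propext key
  have hnull : NullMeasurableSet S preWienerMeasure :=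
    (nullMeasurableSet_setOf_disjoint hκ8 hBc).congr hae.symm
  simp_rw [h1]
  rw [lintegral_indicator_one₀ hnull, measure_congr hae, hd1, Real.one_rpow, ENNReal.ofReal_one, one_mul]

end Summit.CriticalPhenomena.SAWScalingLimit.Theorems.SubseqIdentification.BoundaryAreaLaw

end
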